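import Summits.Ventures.Crystal3D.Theorems.StickyWulffConstantCoaxialWallLawReflectionWordsNormalForm
import Summits.Ventures.Crystal3D.Theorems.StickyWulffConstantCoaxialWallLawReadingDirections
import Summits.Ventures.Crystal3D.Theorems.StickyWulffConstantCoaxialWallLawForeignTilt
import Summits.Ventures.Crystal3D.Theorems.StickyWulffConstantGenericWallFloorDoubleTopLocalFrame
import HarnessLib

/-!
# Reduced words in the four `{111}` reflections, III: transport to `ℝ³` — letters and words as linear isometries,
# `Γ₀ ∩ O_h = {1}` and slot-dozen rigidity for `fccSlots`, model menu normals are letters, `PlateSystem.Fw` as a word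
# (crux `CoaxialWallLaw`, stmt-Ventures-19481, line `WallLedgerF`; item (L1) of the module-capture plan, concluded)

HONEST FRAMING. Venture `Summits/Ventures/Crystal3D` (cell `crystal3d-full`), helper `--supports` the crux `CoaxialWallLaw`
of `route-Ventures-StickyWulffConstant` (REGISTERED line `WallLedgerF`, skeleton `Certificates` v3, registered stub
`stub_moduleCapture`).  Continues `…ReflectionWords` / `…ReflectionWordsNormalForm` (pure algebra over `ℚ` / `ZMod 3`) and
transports them to the tree's real vocabulary (`cubicCoords`, `fccSlots`, `slotSite`, `inclinedNormal`, `inclIso`,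
`PlateSystem.Fw`).  Rung credit only; F-C1 not moved; census-free.

* `nrmVec` — the four unit normals `e₃, inclinedNormal 0, 1, 2`; `cubicCoords_nrmVec : cubicCoords (nrmVec i) = nrm i/√3`;
  `letterIso i = (ℝ ∙ nrmVec i)ᗮ.reflection` (`letterIso_succ : letterIso (c+1) = inclIso c`), `cubicCoords_letterIso`
  (the letter acts by `M_i` on cubic coordinates);
* `wordIso` — words as linear isometries in the recursion of `PlateSystem.Fw` (head letter FIRST), `wordIso_append`,
  `cubicCoords_wordIso` (cubic matrix `wordMat w.reverse`), `wordIso_eq_iff_wordMat_eq`, **`wordIso_eq_iff : wordIso u =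
  wordIso v ↔ reduce u = reduce v`**, `wordIso_eq_refl_iff`, `wordIso_reverse = symm`;
* `reduce_eq_nil_of_image_fccSlots_subset` — **`Γ₀ ∩ O_h = {1}` / trivial stabiliser of `D₊`**: a word mapping `fccSlots` into
  itself is trivial; `image_fccSlots_eq_iff` / `eq_of_image_fccSlots_eq` — **RIGIDITY**: `wordIso u '' fccSlots = wordIso v ''
  fccSlots ↔ reduce u = reduce v` (reduced words with the same slot-dozen image are equal);
* `exists_nrmVec_of_menu` — a unit model menu normal (`⟪w, μ⟫ ∈ {0, ±√(2/3)}` on the slots) is `± nrmVec i`;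
  `reflection_eq_letterIso`; `fw_eq_wordIso_trans` — for model letters `κ = ±nrmVec ∘ w`: `S.Fw κ = (wordIso w).trans S.G₀`.
WHAT THIS IS NOT: not the stub; the letter table of the roots / alternation (`WFChain`) and the class capture are (L2)–(L3) of
the plan (19481-p2); F-C1 not moved.
-/

noncomputable section

namespace Summit.Ventures.Crystal3D.Theorems

namespace ReflWord

open Summit.Ventures.Crystal3D Matrix NearIdentity TailResidue
open scoped InnerProductSpace

/-- Rational matrices as real matrices. -/
def castR : Matrix (Fin 3) (Fin 3) ℚ →+* Matrix (Fin 3) (Fin 3) ℝ := (Rat.castHom ℝ).mapMatrix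

/-- Entries of the cast matrix. -/
@[simp] theorem castR_apply (A : Matrix (Fin 3) (Fin 3) ℚ) (a b : Fin 3) : castR A a b = ((A a b : ℚ) : ℝ) := rfl

/-- `castR` is injective. -/
theorem castR_injective : Function.Injective castR := by
  intro A B h
  ext a b
  have hab := congr_fun (congr_fun h a) b
  simpa using hab

/-- The normals as real vectors (integer cubic coordinates, norm `√3`). -/
def nrmR (i : Fin 4) : Fin 3 → ℝ := fun a => (nrm i a : ℝ)

/-- `castR (M_i) = 1 − ⅔ nᵢnᵢᵀ` over `ℝ`. -/
theorem castR_M (i : Fin 4) : castR (M i) = 1 - (2 / 3 : ℝ) • vecMulVec (nrmR i) (nrmR i) := by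
  ext a b
  simp only [castR_apply, M, nrmQ, nrmR, Matrix.sub_apply, Matrix.smul_apply, Matrix.one_apply, vecMulVec_apply,
    smul_eq_mul]
  split_ifs <;> push_cast <;> ring

/-- **The four unit `{111}` normals of `D₊`** as vectors of `ℝ³`, in the order of the letters: the basal axis `e₃` and the
three inclined normals `inclinedNormal 0, 1, 2` of the module (`…TailResidueDefs`). -/
def nrmVec : Fin 4 → EuclideanSpace ℝ (Fin 3) :=
  ![EuclideanSpace.single 2 1, inclinedNormal 0, inclinedNormal 1, inclinedNormal 2]

/-- Letter `0` is the basal axis. -/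
@[simp] theorem nrmVec_zero : nrmVec 0 = EuclideanSpace.single 2 1 := rfl

/-- Letter `1` is the inclined normal `0`. -/
@[simp] theorem nrmVec_one : nrmVec 1 = inclinedNormal 0 := rfl

/-- Letter `2` is the inclined normal `1`. -/
@[simp] theorem nrmVec_two : nrmVec 2 = inclinedNormal 1 := rfl

/-- Letter `3` is the inclined normal `2`. -/
@[simp] theorem nrmVec_three : nrmVec 3 = inclinedNormal 2 := rfl

/-- `(√6)⁻¹ · 18/(9√2) = 1/√3`. -/
theorem sqrt6_inv_mul : (Real.sqrt 6)⁻¹ * ((18 : ℝ) / (9 * Real.sqrt 2)) = (Real.sqrt 3)⁻¹ := by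
  have h2 : Real.sqrt 2 ≠ 0 := by positivity
  have h3 : Real.sqrt 3 ≠ 0 := by positivity
  have h6 : Real.sqrt 6 = Real.sqrt 2 * Real.sqrt 3 := by
    rw [← Real.sqrt_mul (by norm_num : (0 : ℝ) ≤ 2)]; norm_num
  have hs2 : Real.sqrt 2 ^ 2 = 2 := Real.sq_sqrt (by norm_num)
  rw [h6]
  field_simp
  linear_combination (-9) * hs2

/-- The inclined normals in cubic coordinates. -/
theorem cubicCoords_inclinedNormal (c : Fin 3) :
    cubicCoords (inclinedNormal (Fin.castLE (by norm_num) c)) = (Real.sqrt 3)⁻¹ • nrmR c.succ := by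
  have key := sqrt6_inv_mul
  rw [inclinedNormal_eq, cubicCoords_smul, cubicCoords_fineVec]
  ext a
  fin_cases c <;> fin_cases a <;> simp [normFine, nrmR, nrm] <;>
    first | linear_combination key | linear_combination (-1) * key

/-- **Cubic coordinates of the normals**: `cubicCoords (nrmVec i) = nrm i / √3` — `e₃ ↦ (−1,1,1)/√3`, the inclined
normals `↦ (1,1,1)/√3, (−1,−1,1)/√3, (−1,1,−1)/√3`. -/
theorem cubicCoords_nrmVec (i : Fin 4) : cubicCoords (nrmVec i) = (Real.sqrt 3)⁻¹ • nrmR i := by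
  have h2 : Real.sqrt 2 ≠ 0 := by positivity
  have h3 : Real.sqrt 3 ≠ 0 := by positivity
  have h23 : Real.sqrt (2 / 3) = Real.sqrt 2 / Real.sqrt 3 := by rw [Real.sqrt_div (by norm_num : (0 : ℝ) ≤ 2)]
  fin_cases i
  · ext a
    fin_cases a <;> simp [cubicCoords, nrmR, nrm, h23] <;> field_simp
  · exact cubicCoords_inclinedNormal 0
  · exact cubicCoords_inclinedNormal 1
  · exact cubicCoords_inclinedNormal 2

/-- The normals are unit vectors. -/
theorem norm_nrmVec (i : Fin 4) : ‖nrmVec i‖ = 1 := by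
  fin_cases i
  · show ‖EuclideanSpace.single (2 : Fin 3) (1 : ℝ)‖ = 1
    rw [PiLp.norm_single, norm_one]
  · exact norm_inclinedNormal 0
  · exact norm_inclinedNormal 1
  · exact norm_inclinedNormal 2

/-- **The letter `i` as a linear isometry**: the reflection of `ℝ³` across the plane `(nrmVec i)^⊥` through the origin
(for `i ≥ 1` this is `inclIso (i − 1)` of `…ReadingDirections`; for `i = 0` the basal mirror `x ↦ x − 2x₃e₃`). -/
def letterIso (i : Fin 4) : EuclideanSpace ℝ (Fin 3) ≃ₗᵢ[ℝ] EuclideanSpace ℝ (Fin 3) := (ℝ ∙ nrmVec i)ᗮ.reflection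

/-- The letters `1, 2, 3` are the inclined mirrors of `…ReadingDirections`. -/
theorem letterIso_succ (c : Fin 3) : letterIso c.succ = inclIso (Fin.castLE (by norm_num) c) := by
  fin_cases c <;> rfl

/-- The reflection formula. -/
theorem letterIso_apply (i : Fin 4) (x : EuclideanSpace ℝ (Fin 3)) :
    letterIso i x = x - (2 * ⟪x, nrmVec i⟫_ℝ) • nrmVec i :=
  reflection_unit_apply (norm_nrmVec i) x

/-- A letter is an involution. -/
theorem letterIso_letterIso (i : Fin 4) (x : EuclideanSpace ℝ (Fin 3)) : letterIso i (letterIso i x) = x :=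
  Submodule.reflection_reflection _ x

/-- **The letters act by `M_i` on cubic coordinates.** -/
theorem cubicCoords_letterIso (i : Fin 4) (x : EuclideanSpace ℝ (Fin 3)) :
    cubicCoords (letterIso i x) = castR (M i) *ᵥ cubicCoords x := by
  have h3 : (Real.sqrt 3)⁻¹ * (Real.sqrt 3)⁻¹ = 3⁻¹ := by
    rw [← mul_inv, Real.mul_self_sqrt (by norm_num)]
  rw [letterIso_apply, cubicCoords_sub, cubicCoords_smul, inner_eq_cubicCoords, cubicCoords_nrmVec, castR_M,
    Matrix.sub_mulVec, Matrix.one_mulVec, smul_vecMulVec_mulVec, dotProduct_smul, smul_smul, dotProduct_comm (nrmR i),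
    smul_eq_mul]
  congr 2
  linear_combination (2 * (cubicCoords x ⬝ᵥ nrmR i)) * h3

/-- **Words as linear isometries**, in the recursion of `PlateSystem.Fw`: `wordIso (i :: w) = (letterIso i).trans (wordIso w)`
— the HEAD letter acts FIRST (so `wordIso w` has cubic matrix `wordMat w.reverse`). -/
def wordIso : List (Fin 4) → (EuclideanSpace ℝ (Fin 3) ≃ₗᵢ[ℝ] EuclideanSpace ℝ (Fin 3))
  | [] => LinearIsometryEquiv.refl ℝ _
  | i :: w => (letterIso i).trans (wordIso w)

/-- The empty word is the identity. -/
@[simp] theorem wordIso_nil : wordIso [] = LinearIsometryEquiv.refl ℝ _ := rfl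

/-- `wordIso (i :: w) = (letterIso i).trans (wordIso w)`. -/
theorem wordIso_cons (i : Fin 4) (w : List (Fin 4)) : wordIso (i :: w) = (letterIso i).trans (wordIso w) := rfl

/-- Concatenation is composition (first word first). -/
theorem wordIso_append (u v : List (Fin 4)) : wordIso (u ++ v) = (wordIso u).trans (wordIso v) := by
  induction u with
  | nil => rw [List.nil_append, wordIso_nil, LinearIsometryEquiv.refl_trans]
  | cons i u ih => rw [List.cons_append, wordIso_cons, wordIso_cons, ih, LinearIsometryEquiv.trans_assoc]

/-- **Words act by `wordMat w.reverse` on cubic coordinates.** -/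
theorem cubicCoords_wordIso (w : List (Fin 4)) (x : EuclideanSpace ℝ (Fin 3)) :
    cubicCoords (wordIso w x) = castR (wordMat w.reverse) *ᵥ cubicCoords x := by
  induction w generalizing x with
  | nil => simp [castR]
  | cons i w ih =>
    rw [wordIso_cons, LinearIsometryEquiv.trans_apply, ih, cubicCoords_letterIso, Matrix.mulVec_mulVec, ← map_mul,
      List.reverse_cons, wordMat_append, wordMat_singleton]

/-- **A word is determined by its matrix**: `wordIso u = wordIso v ↔ wordMat u = wordMat v`. -/
theorem wordIso_eq_iff_wordMat_eq (u v : List (Fin 4)) : wordIso u = wordIso v ↔ wordMat u = wordMat v := by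
  constructor
  · intro h
    rw [← wordMat_reverse_eq_iff]
    apply castR_injective
    refine Matrix.ext_of_mulVec_single fun b => ?_
    have hb := congr_arg cubicCoords (LinearIsometryEquiv.congr_fun h (cubicFrame b))
    rwa [cubicCoords_wordIso, cubicCoords_wordIso, cubicCoords_cubicFrame] at hb
  · intro h
    rw [← wordMat_reverse_eq_iff] at h
    ext x : 1
    apply cubicCoords_injective
    rw [cubicCoords_wordIso, cubicCoords_wordIso, h]

/-- **NORMAL FORM, real form**: `wordIso u = wordIso v ↔ reduce u = reduce v`; two REDUCED words define the same isometry iff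
they are equal. -/
theorem wordIso_eq_iff (u v : List (Fin 4)) : wordIso u = wordIso v ↔ reduce u = reduce v := by
  rw [wordIso_eq_iff_wordMat_eq, wordMat_eq_iff_reduce_eq]

/-- `wordIso w = 1 ↔ reduce w = []`. -/
theorem wordIso_eq_refl_iff (w : List (Fin 4)) : wordIso w = LinearIsometryEquiv.refl ℝ _ ↔ reduce w = [] := by
  rw [← wordIso_nil, wordIso_eq_iff, reduce_nil]

/-- The reversed word is the inverse isometry. -/
theorem wordIso_reverse (w : List (Fin 4)) : wordIso w.reverse = (wordIso w).symm := by
  have h1 : wordIso (w ++ w.reverse) = LinearIsometryEquiv.refl ℝ _ := by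
    rw [← wordIso_nil, wordIso_eq_iff_wordMat_eq, wordMat_append, wordMat_mul_reverse, wordMat_nil]
  rw [wordIso_append] at h1
  ext x : 1
  have hx := LinearIsometryEquiv.congr_fun h1 ((wordIso w).symm x)
  rw [LinearIsometryEquiv.trans_apply, LinearIsometryEquiv.apply_symm_apply] at hx
  exact hx

/-! ### The slot dozen: `Γ₀ ∩ O_h = {1}` and rigidity of slot images -/

/-- Slots in cubic coordinates: `cubicCoords (slotSite s) = slotQ s / √2`. -/
theorem cubicCoords_slotSite_eq (s : Fin 12) : cubicCoords (slotSite s) = (Real.sqrt 2)⁻¹ • fun a => ((slotQ s a : ℚ) : ℝ) := by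
  rw [cubicCoords_slotSite]
  ext a
  simp [slotVec, slotQ, div_eq_inv_mul]

/-- Casting `A *ᵥ q` from `ℚ` to `ℝ`. -/
theorem castR_mulVec (A : Matrix (Fin 3) (Fin 3) ℚ) (q : Fin 3 → ℚ) :
    castR A *ᵥ (fun b => ((q b : ℚ) : ℝ)) = fun a => (((A *ᵥ q) a : ℚ) : ℝ) := by
  ext a
  simp [Matrix.mulVec, dotProduct, castR_apply]

/-- **A word maps a slot to a slot iff its matrix does**: `wordIso w (slotSite s) = slotSite s' ↔
wordMat w.reverse *ᵥ slotQ s = slotQ s'`. -/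
theorem wordIso_slotSite_eq_iff (w : List (Fin 4)) (s s' : Fin 12) :
    wordIso w (slotSite s) = slotSite s' ↔ wordMat w.reverse *ᵥ slotQ s = slotQ s' := by
  have h2 : (Real.sqrt 2)⁻¹ ≠ 0 := by positivity
  rw [← cubicCoords_injective.eq_iff, cubicCoords_wordIso, cubicCoords_slotSite_eq, cubicCoords_slotSite_eq,
    Matrix.mulVec_smul, castR_mulVec, (smul_right_injective (Fin 3 → ℝ) h2).eq_iff]
  constructor
  · intro h
    ext a
    exact_mod_cast congr_fun h a
  · intro h
    rw [h]

/-- **`Γ₀ ∩ O_h = {1}` / TRIVIAL STABILISER OF `D₊` (real form).**  A word that maps the slot dozen `fccSlots` into itself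
reduces to the empty word (and is the identity isometry, `wordIso_eq_refl_iff`). -/
theorem reduce_eq_nil_of_image_fccSlots_subset {w : List (Fin 4)}
    (h : wordIso w '' (↑fccSlots : Set (EuclideanSpace ℝ (Fin 3))) ⊆ ↑fccSlots) : reduce w = [] := by
  have hrev : reduce w.reverse = [] := by
    apply reduce_eq_nil_of_mapsTo_slots
    intro s
    have hs : wordIso w (slotSite s) ∈ (↑fccSlots : Set (EuclideanSpace ℝ (Fin 3))) :=
      h ⟨slotSite s, Finset.mem_coe.2 (slotSite_mem s), rfl⟩
    obtain ⟨s', hs'⟩ := exists_slotSite_eq (Finset.mem_coe.1 hs)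
    exact ⟨s', (wordIso_slotSite_eq_iff w s s').1 hs'.symm⟩
  have h1 : wordMat w.reverse = 1 := (wordMat_eq_one_iff _).2 hrev
  rw [← wordMat_eq_one_iff]
  calc wordMat w = wordMat w * wordMat w.reverse := by rw [h1, mul_one]
    _ = 1 := wordMat_mul_reverse w

/-- **RIGIDITY OF THE SLOT DOZEN (real form).**  Two words give the same slot-dozen image iff they have the same normal form;
in particular two REDUCED words with `wordIso u '' fccSlots = wordIso v '' fccSlots` are EQUAL. -/
theorem image_fccSlots_eq_iff (u v : List (Fin 4)) :
    wordIso u '' (↑fccSlots : Set (EuclideanSpace ℝ (Fin 3))) = wordIso v '' ↑fccSlots ↔ reduce u = reduce v := by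
  constructor
  · intro h
    have hsub : wordIso (u ++ v.reverse) '' (↑fccSlots : Set (EuclideanSpace ℝ (Fin 3))) ⊆ ↑fccSlots := by
      rw [wordIso_append, LinearIsometryEquiv.coe_trans, Set.image_comp, h, wordIso_reverse, ← Set.image_comp]
      rintro _ ⟨x, hx, rfl⟩
      simpa using hx
    have h0 := reduce_eq_nil_of_image_fccSlots_subset hsub
    rw [← wordMat_eq_one_iff, wordMat_append] at h0
    rw [← wordMat_eq_iff_reduce_eq]
    calc wordMat u = wordMat u * (wordMat v.reverse * wordMat v) := by rw [wordMat_reverse_mul, mul_one]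
      _ = wordMat v := by rw [← mul_assoc, h0, one_mul]
  · intro h
    rw [(wordIso_eq_iff u v).2 h]

/-- Reduced words with the same slot-dozen image are equal. -/
theorem eq_of_image_fccSlots_eq {u v : List (Fin 4)} (hu : u.IsChain (· ≠ ·)) (hv : v.IsChain (· ≠ ·))
    (h : wordIso u '' (↑fccSlots : Set (EuclideanSpace ℝ (Fin 3))) = wordIso v '' ↑fccSlots) : u = v := by
  rw [← reduce_eq_self hu, ← reduce_eq_self hv]
  exact (image_fccSlots_eq_iff u v).1 h

/-! ### Letters from model menu normals; `PlateSystem.Fw` as a word isometry -/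

/-- Every sign pattern `(±1, ±1, ±1)` is `± n_i` for one of the four normals (kernel-decided). -/
theorem sign_pattern_eq_nrm : ∀ s : Fin 3 → Fin 2, ∃ i : Fin 4, ∃ e : Fin 2,
    ∀ j : Fin 3, (![(1 : ℤ), -1] : Fin 2 → ℤ) (s j) = (![(1 : ℤ), -1] : Fin 2 → ℤ) e * nrm i j := by
  decide

/-- **MODEL MENU NORMALS ARE LETTERS.**  A unit vector `μ` with `⟪w, μ⟫ ∈ {0, ±√(2/3)}` for all twelve slots `w` (a menu
normal of the identity frame, i.e. a `{111}` normal of `D₊`) is `± nrmVec i` for exactly one letter `i`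
(from `menu_cubic_coords_pm_one`: its cubic coordinates are `(±1,±1,±1)/√3`). -/
theorem exists_nrmVec_of_menu {μ : EuclideanSpace ℝ (Fin 3)} (hμ : ‖μ‖ = 1)
    (hmenu : ∀ w ∈ fccSlots, ⟪w, μ⟫_ℝ = 0 ∨ ⟪w, μ⟫_ℝ = Real.sqrt (2 / 3) ∨ ⟪w, μ⟫_ℝ = -Real.sqrt (2 / 3)) :
    ∃ i : Fin 4, μ = nrmVec i ∨ μ = -nrmVec i := by
  have hmenu' : ∀ w ∈ fccSlots,
      ⟪(LinearIsometryEquiv.refl ℝ (EuclideanSpace ℝ (Fin 3))) w, μ⟫_ℝ = 0 ∨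
      ⟪(LinearIsometryEquiv.refl ℝ (EuclideanSpace ℝ (Fin 3))) w, μ⟫_ℝ = Real.sqrt (2 / 3) ∨
      ⟪(LinearIsometryEquiv.refl ℝ (EuclideanSpace ℝ (Fin 3))) w, μ⟫_ℝ = -Real.sqrt (2 / 3) := by
    intro w hw; simpa using hmenu w hw
  obtain ⟨k, hk, hkj⟩ := menu_cubic_coords_pm_one (LinearIsometryEquiv.refl ℝ _) hμ hmenu'
  simp only [LinearIsometryEquiv.coe_refl, id] at hkj
  obtain ⟨i, e, hie⟩ := sign_pattern_eq_nrm fun j => if k j = 1 then 0 else 1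
  have hs : ∀ j, (![(1 : ℤ), -1] : Fin 2 → ℤ) (if k j = 1 then 0 else 1) = k j := by
    intro j; rcases hk j with h | h <;> simp [h]
  have h3 : Real.sqrt 3 ≠ 0 := by positivity
  have hc : cubicCoords μ = (((![(1 : ℤ), -1] : Fin 2 → ℤ) e : ℤ) : ℝ) • cubicCoords (nrmVec i) := by
    ext j
    rw [cubicCoords_nrmVec, Pi.smul_apply, Pi.smul_apply, smul_eq_mul, smul_eq_mul, nrmR]
    have hj := hkj j
    rw [real_inner_comm, inner_cubicFrame, ← hs j, hie j] at hj
    push_cast at hj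
    field_simp
    linear_combination hj
  fin_cases e
  · refine ⟨i, Or.inl (cubicCoords_injective ?_)⟩
    rw [hc]; simp
  · refine ⟨i, Or.inr (cubicCoords_injective ?_)⟩
    rw [hc, cubicCoords_neg]; simp

/-- The mirror across `± nrmVec i` is the letter `i`. -/
theorem reflection_eq_letterIso {μ : EuclideanSpace ℝ (Fin 3)} {i : Fin 4} (h : μ = nrmVec i ∨ μ = -nrmVec i) :
    (ℝ ∙ μ)ᗮ.reflection = letterIso i := by
  rcases h with rfl | rfl
  · rfl
  · ext x : 1
    have hn : ‖-nrmVec i‖ = 1 := by rw [norm_neg, norm_nrmVec]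
    rw [reflection_unit_apply hn, letterIso_apply, inner_neg_right, smul_neg, mul_neg, neg_smul, neg_neg]

/-- **`PlateSystem.Fw` IS THE WORD ISOMETRY FOLLOWED BY THE PLATE FRAME.**  If the model letters `κ` are `± nrmVec` of the
word `w` letter by letter, then `S.Fw κ = (wordIso w).trans S.G₀` (`= S.G₀ ∘ wordIso w`; cubic matrix of the word part:
`wordMat w.reverse`, `cubicCoords_wordIso`). -/
theorem fw_eq_wordIso_trans (S : PlateSystem) {κ : List (EuclideanSpace ℝ (Fin 3))} {w : List (Fin 4)}
    (h : List.Forall₂ (fun μ i => μ = nrmVec i ∨ μ = -nrmVec i) κ w) : S.Fw κ = (wordIso w).trans S.G₀ := by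
  induction h with
  | nil => rw [wordIso_nil, LinearIsometryEquiv.refl_trans]; rfl
  | cons hμ _ ih =>
    rw [PlateSystem.Fw, wordIso_cons, reflection_eq_letterIso hμ, ih, LinearIsometryEquiv.trans_assoc]

end ReflWord

end Summit.Ventures.Crystal3D.Theorems

end
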